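import Summits.QuantumFields.YangMills.Theorems.FluctuationComparisonRegPrIntLSupTailCoverUnionTwoRegime
import HarnessLib

/-!
# `FluctuationComparisonRegPrIntLSupTailCoverUnionFibreTail` — THE FIBREWISE CAPSTONE OF THE TAILSUP₁∘ DOOR SUITE: TAILSUP₁∘ `WindowOddsSupDepthOneIntCan` verbatim from TWO NUMBERS per
# (level, fine plaquette) about the Boltzmann-tilted CONDITIONAL HAAR LAW of the fine field given its block average — a window-exit mass ratio and a first moment
# (crux `UnitScaleTilt.FluctuationComparisonRegPrIntL`, stmt-QuantumFields-20520; companion of ✓O `…SupTailCoverUnionTwoRegime`, ✓E `…TailSupOneFibreRows`, ✓L `…SupTailCoverUnion`)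

Cell `ym3-torus` (YM ladder rung R3 = continuum SU(2) Yang–Mills on T³ — a RUNG, NOT the Clay problem: not d = 4, not infinite volume, not a mass gap);
width seat `ym-ust-20520-w3` (gen 17); helper `--supports stmt-QuantumFields-20520`.  THEOREMS ONLY (0 `def`, 0 `sorry`, default heartbeats).

WHAT.  ✓O reduced TAILSUP₁∘ to (i) moderate per-plaquette rows in total-mass currency, (ii) one first moment per level, (iii) smallness.  This file makes (i) FIBREWISE too:
* §1 ★★`pinnedTotal_of_fibrewise` — at any `(J, K)`, measurable `E ⊆ T_K`-fields: if for `(dU_K.map D_{J,K})`-a.e. window datum `V` the Boltzmann-weighted conditional Haar law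
  `κ_V = condLaw dU_K D_{J,K} V` gives `E` at most the fraction `σ` of its total weight, `∫⁻_E e^{−β_K A} dκ_V ≤ ofReal(σ)·∫⁻ e^{−β_K A} dκ_V`, then for every measurable `B` inside
  the window `Gibbs_K(D⁻¹B ∩ E) ≤ ofReal(σ)·Gibbs_K(D⁻¹B)` (✓E `gibbsK_restrict_map_le_of_fibrewise` at `G := univ`, read setwise by ✓L `setwise_of_restrict_map_le_smul`).
* §2 ★★★`condGoodOddsDepthOneInt_of_fibreTail_farMoment` ∕ ★★★`windowOddsSupDepthOneInt_of_fibreTail_farMoment : ⟨FIBRE-TAIL₁∘ + FAR-MOMENT₁∘⟩ → ✓K's ⟨COND-ODDS₁∘⟩ ∕ TAILSUP₁∘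
  verbatim` — hypothesis (TAILSUP₁∘'s prefix, then `∃ δ₀ ≥ 0, J₀, s, q > 0, σm ≥ 0, M` with `Σ_p σm J p + #T_{J+1}·e^{−β_{J+1}δ₀²∕4}·e^{M J} ≤ s J`, `s` superpolynomial and
  EVENTUALLY `≤ ½` (`J ≥ J₀`; at small `J` the plaquette count defeats any union bound once `F.m` is large — px21 g13's flag), the levels `J < J₀` carried by ✓O's FLOOR row
  `ofReal(q J)·Gibbs_{J+1}(D⁻¹B) ≤ Gibbs_{J+1}(D⁻¹B ∩ histGood)`):
  (TAIL) for a.e. interior-window datum `V`: `∫⁻_{θBal L γ b₀ p₀ (J+1) ≤ dist1 U(∂p) < δ₀} e^{−β_{J+1}A} dκ_V ≤ ofReal(σm J p)·∫⁻ e^{−β_{J+1}A} dκ_V`;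
  (MOMENT) for a.e. interior-window datum `V`: `⨍ β_{J+1}(1 − Re tr U(∂p)) d(κ_V.withDensity e^{−β_{J+1}A_{¬p}}) ≤ M J`.
SO THE HAND'S RESIDUE FOR TAILSUP₁∘ IS: per (level `J+1`, fine plaquette `p`), conditional on the block average `V` in the interior window, (TAIL) the tilted conditional law
puts mass fraction `≤ σm J p` on «plaquette `p` leaves its `θBal_{J+1}`-window but stays `δ₀`-moderate» (chart + convexity one level deep) and (MOMENT) one plaquette's
tilted action has mean `≤ M J` under the deleted weight (equipartition), plus eventual `p₀`-smallness and the floor at the finitely many low levels — [Balaban1985UV3]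
(38)–(40) p.266's conditional small-field estimate, per plaquette.
HONEST SCOPE.  Measure bookkeeping; (TAIL), (MOMENT), the eventual smallness and the floor are the HYPOTHESIS; TAILSUP₁∘, MOD₁∘, FAR₁, LFR♯ᶜ∘, S2β, 20520, `YM3TorusSU2`
NOT proved; the Yang–Mills mass gap is NOT proved.
HYP-SAT (cell RULING №42).  All letters (`δ₀, J₀, s, q, σm, M`) are bound AFTER `F, γ`: satisfiable on the literal T³ families at the true quantifier order modulo the
analytic contents named above (none supplied by a hand yet); the smallness is EVENTUAL (`J ≥ J₀(F)`) by design — a `∀ J ≤ ½` edition would be vacuous for large `F.m`.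
References: [Balaban1985UV3] (2) p. 256, (7) p. 257, (38)–(40) p. 266, (67)–(71) p. 273; [Balaban1985Averaging] (10) p. 19.
-/

noncomputable section

set_option autoImplicit false

open MeasureTheory ProbabilityTheory Filter Topology Set
open scoped ENNReal NNReal BigOperators
open Literature.MathematicalPhysics.QuantumFieldTheory.Balaban1983to89
open Literature.MathematicalPhysics.QuantumFieldTheory.Balaban1983to89.T3ContinuumYM3Torus
open Literature.MathematicalPhysics.QuantumFieldTheory.Balaban1983to89.T3NestedUnitLaws
open Literature.MathematicalPhysics.QuantumFieldTheory.Balaban1983to89.T3UnitLawDensityEML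
open Literature.MathematicalPhysics.QuantumFieldTheory.Balaban1983to89.T3UnitScaleTilt
open Literature.MathematicalPhysics.QuantumFieldTheory.Balaban1983to89.T3TiltDescent
open Literature.MathematicalPhysics.QuantumFieldTheory.Balaban1983to89.Missing
open Literature.MathematicalPhysics.QuantumFieldTheory.Balaban1983to89.T4AveragingDisintegration
open scoped Literature.MathematicalPhysics.QuantumFieldTheory.Balaban1983to89.T3OrbitAverage
open Summit.QuantumFields.YangMills.Theorems.FluctuationComparisonRegPrIntLWregGlue (heightDensityCan)
open Summit.QuantumFields.YangMills.Theorems.FluctuationComparisonRegPrIntLSupTailCoverUnionTwoRegime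

namespace Summit.QuantumFields.YangMills.Theorems.FluctuationComparisonRegPrIntLSupTailCoverUnionFibreTail

/-! ## §1 A total-mass regime row from a fibrewise mass fraction -/

section Fibre

variable (F : T3Family) {γ : ℝ} (b₀ p₀ : ℝ) {J K : ℕ} (hJK : J ≤ K)

/-- ★★ **TOTAL-MASS ROW ⟸ FIBREWISE MASS FRACTION**: for a measurable set `E` of run-`K` fine fields, if for `(dU_K.map D_{J,K})`-a.e. window datum `V` the Boltzmann-weighted
conditional Haar law gives `E` at most the fraction `σ` of its total weight, `∫⁻_E ofReal(boltzmann β_K) dκ_V ≤ ofReal(σ)·∫⁻ ofReal(boltzmann β_K) dκ_V`, then for every measurable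
`B` inside the height-`J` window `{PlaqSmall (θBal L γ b₀ p₀ J)}`: `Gibbs_K(D⁻¹B ∩ E) ≤ ofReal(σ)·Gibbs_K(D⁻¹B)` (✓E at `G := univ`, ✓L setwise).  Profile free (`b₀ ↦ c·b₀`).
[cite: Balaban1985UV3, (38)-(40) p.266; Balaban1985Averaging, (10) p.19] -/
theorem pinnedTotal_of_fibrewise {E : Set (GaugeField (F.P K) 0 (Matrix.specialUnitaryGroup (Fin 2) ℂ))} (hE : MeasurableSet E) {σ : ℝ}
    (hfib : ∀ᵐ V ∂((fieldMeasure (F.P K) 0 (Matrix.specialUnitaryGroup (Fin 2) ℂ)).map (descendTo F ℰp J K hJK)),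
      PlaqSmall (θBal F.L γ b₀ p₀ J) V →
        ∫⁻ U in E, ENNReal.ofReal (boltzmann (F.P K) ((F.scheme ℰp γ).β K) U)
            ∂(condLaw (fieldMeasure (F.P K) 0 (Matrix.specialUnitaryGroup (Fin 2) ℂ)) (descendTo F ℰp J K hJK) V) ≤
          ENNReal.ofReal σ * ∫⁻ U, ENNReal.ofReal (boltzmann (F.P K) ((F.scheme ℰp γ).β K) U)
            ∂(condLaw (fieldMeasure (F.P K) 0 (Matrix.specialUnitaryGroup (Fin 2) ℂ)) (descendTo F ℰp J K hJK) V))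
    {B : Set (GaugeField (F.P J) 0 (Matrix.specialUnitaryGroup (Fin 2) ℂ))} (hB : MeasurableSet B) (hBW : B ⊆ {U | PlaqSmall (θBal F.L γ b₀ p₀ J) U}) :
    gibbsK F ℰp γ K (descendTo F ℰp J K hJK ⁻¹' B ∩ E) ≤ ENNReal.ofReal σ * gibbsK F ℰp γ K (descendTo F ℰp J K hJK ⁻¹' B) := by
  have hD : Measurable (descendTo F ℰp J K hJK) := measurable_descendTo F ℰp measurableE_ℰp hJK
  have hfib' : ∀ᵐ V ∂((fieldMeasure (F.P K) 0 (Matrix.specialUnitaryGroup (Fin 2) ℂ)).map (descendTo F ℰp J K hJK)),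
      PlaqSmall (θBal F.L γ b₀ p₀ J) V →
        ∫⁻ U in E, ENNReal.ofReal (boltzmann (F.P K) ((F.scheme ℰp γ).β K) U)
            ∂(condLaw (fieldMeasure (F.P K) 0 (Matrix.specialUnitaryGroup (Fin 2) ℂ)) (descendTo F ℰp J K hJK) V) ≤
          ENNReal.ofReal σ * ∫⁻ U in Set.univ, ENNReal.ofReal (boltzmann (F.P K) ((F.scheme ℰp γ).β K) U)
            ∂(condLaw (fieldMeasure (F.P K) 0 (Matrix.specialUnitaryGroup (Fin 2) ℂ)) (descendTo F ℰp J K hJK) V) := by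
    filter_upwards [hfib] with V hV hVW
    rw [Measure.restrict_univ]
    exact hV hVW
  have hrow := FluctuationComparisonRegPrIntLTailSupOneFibreRows.gibbsK_restrict_map_le_of_fibrewise F b₀ p₀ hJK hE MeasurableSet.univ hfib'
  rw [Measure.restrict_univ] at hrow
  have hset := FluctuationComparisonRegPrIntLSupTailCoverUnion.setwise_of_restrict_map_le_smul (gibbsK F ℰp γ K) hD (E := E) (G := Set.univ)
    (by rwa [Measure.restrict_univ]) hB hBW
  rwa [Set.inter_univ] at hset

/-- The moderate pinned event of one fine plaquette is measurable. [folklore] -/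
theorem measurableSet_modPinned (θ δ₀ : ℝ) (p : Plaq (F.P K) 0) :
    MeasurableSet {U : GaugeField (F.P K) 0 (Matrix.specialUnitaryGroup (Fin 2) ℂ) |
      θ ≤ dist1 (GaugeField.plaqHol U p) ∧ dist1 (GaugeField.plaqHol U p) < δ₀} := by
  have hm : Measurable fun U : GaugeField (F.P K) 0 (Matrix.specialUnitaryGroup (Fin 2) ℂ) => dist1 (GaugeField.plaqHol U p) :=
    RegularGaugeGroup.measurable_dist1.comp (Missing.measurable_plaqHol p)
  exact (measurableSet_le measurable_const hm).inter (measurableSet_lt hm measurable_const)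

end Fibre

/-! ## §2 The knit: fibre tails + far first moments + smallness ⇒ ✓K's ⟨COND-ODDS₁∘⟩ ⇒ TAILSUP₁∘ verbatim -/

section Knit

/-- ★★★ **⟨FIBRE-TAIL₁∘ + FAR-MOMENT₁∘ + FLOOR⟩ ⇒ ✓K's ⟨COND-ODDS₁∘⟩ VERBATIM** (`τ J = if J < J₀ then max 0 (−log q J) else 2·s J`): hypothesis = TAILSUP₁∘'s quantifier prefix, then
`∃ δ₀ ≥ 0, J₀`, a smallness profile `s ≥ 0` (superpolynomially small, `≤ ½` for `J ≥ J₀`), a floor `q > 0`, weights `σm J p ≥ 0` and moments `M J` with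
`Σ_p σm J p + #T_{J+1}·e^{−β_{J+1}δ₀²∕4}·e^{M J} ≤ s J`; (FLOOR) as in ✓O for `J < J₀`; and for every level `J` and fine plaquette `p ∈ T_{J+1}`, for `(dU_{J+1}.map D)`-a.e.
datum `V` in the INTERIOR window: (TAIL) `∫⁻_{θBal_{J+1} ≤ dist1 U(∂p) < δ₀} boltzmann dκ_V ≤ ofReal(σm J p)·∫⁻ boltzmann dκ_V`, (MOMENT) `⨍ β_{J+1}(1 − Re tr U(∂p)) d(κ_V.withDensity
e^{−β_{J+1}A_{¬p}}) ≤ M J`.  §1 turns (TAIL) into ✓O's (MOD) rows; then ✓O `condGoodOddsDepthOneInt_of_modTotal_farMoment`.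
[cite: Balaban1985UV3, (2) p.256, (7) p.257, (38)-(40) p.266 and (67)-(71) p.273] -/
theorem condGoodOddsDepthOneInt_of_fibreTail_farMoment
    (h : ∀ (L : ℕ), ∃ c₀ : ℝ, 0 < c₀ ∧ c₀ ≤ 1 ∧ ∀ (c : ℝ), 0 < c → c ≤ c₀ → ∃ pS : ℝ, ∀ (b₀ p₀ : ℝ), 0 < b₀ → pS ≤ p₀ → 0 < p₀ →
      ∃ γ₁ : ℝ, 0 < γ₁ ∧ ∀ (F : T3Family) (γ : ℝ), F.L = L → 0 < γ → γ ≤ γ₁ →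
        ∃ (δ₀ : ℝ) (J₀ : ℕ) (s q : ℕ → ℝ) (σm : (J : ℕ) → Plaq (F.P (J + 1)) 0 → ℝ) (M : ℕ → ℝ), 0 ≤ δ₀ ∧ (∀ J, 0 ≤ s J) ∧ (∀ J, J₀ ≤ J → s J ≤ 1 / 2) ∧
          (∀ a : ℕ, Tendsto (fun J : ℕ => ((J : ℝ) + 1) ^ a * s J) atTop (𝓝 0)) ∧ (∀ J p, 0 ≤ σm J p) ∧
          (∀ J, ∑ p : Plaq (F.P (J + 1)) 0, σm J p +
              (Fintype.card (Plaq (F.P (J + 1)) 0) : ℝ) * (Real.exp (-((F.scheme ℰp γ).β (J + 1) * δ₀ ^ 2 / 4)) * Real.exp (M J)) ≤ s J) ∧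
          (∀ J, 0 < q J) ∧
          (∀ (J : ℕ), J < J₀ → ∀ (B : Set (GaugeField (F.P J) 0 (Matrix.specialUnitaryGroup (Fin 2) ℂ))), MeasurableSet B →
            B ⊆ {U | PlaqSmall (θBal F.L γ (c * b₀) p₀ J) U} →
            ENNReal.ofReal (q J) * gibbsK F ℰp γ (J + 1) (descendTo F ℰp J (J + 1) (Nat.le_succ J) ⁻¹' B) ≤
              gibbsK F ℰp γ (J + 1) (descendTo F ℰp J (J + 1) (Nat.le_succ J) ⁻¹' B ∩ histGood F ℰp (θBal F.L γ b₀ p₀) (J + 1) J)) ∧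
          (∀ (J : ℕ) (p : Plaq (F.P (J + 1)) 0),
            ∀ᵐ V ∂((fieldMeasure (F.P (J + 1)) 0 (Matrix.specialUnitaryGroup (Fin 2) ℂ)).map (descendTo F ℰp J (J + 1) (Nat.le_succ J))),
              PlaqSmall (θBal F.L γ (c * b₀) p₀ J) V →
                ∫⁻ U in {U | θBal F.L γ b₀ p₀ (J + 1) ≤ dist1 (GaugeField.plaqHol U p) ∧ dist1 (GaugeField.plaqHol U p) < δ₀},
                    ENNReal.ofReal (boltzmann (F.P (J + 1)) ((F.scheme ℰp γ).β (J + 1)) U)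
                    ∂(condLaw (fieldMeasure (F.P (J + 1)) 0 (Matrix.specialUnitaryGroup (Fin 2) ℂ)) (descendTo F ℰp J (J + 1) (Nat.le_succ J)) V) ≤
                  ENNReal.ofReal (σm J p) * ∫⁻ U, ENNReal.ofReal (boltzmann (F.P (J + 1)) ((F.scheme ℰp γ).β (J + 1)) U)
                    ∂(condLaw (fieldMeasure (F.P (J + 1)) 0 (Matrix.specialUnitaryGroup (Fin 2) ℂ)) (descendTo F ℰp J (J + 1) (Nat.le_succ J)) V)) ∧
          (∀ (J : ℕ) (p : Plaq (F.P (J + 1)) 0),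
            ∀ᵐ V ∂((fieldMeasure (F.P (J + 1)) 0 (Matrix.specialUnitaryGroup (Fin 2) ℂ)).map (descendTo F ℰp J (J + 1) (Nat.le_succ J))),
              PlaqSmall (θBal F.L γ (c * b₀) p₀ J) V →
                ⨍ U, (F.scheme ℰp γ).β (J + 1) * (1 - reTr (GaugeField.plaqHol U p))
                  ∂((condLaw (fieldMeasure (F.P (J + 1)) 0 (Matrix.specialUnitaryGroup (Fin 2) ℂ)) (descendTo F ℰp J (J + 1) (Nat.le_succ J)) V).withDensity
                    fun U => ENNReal.ofReal (Real.exp (-((F.scheme ℰp γ).β (J + 1) *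
                      (wilsonAction4 U - (1 - reTr (GaugeField.plaqHol U p))))))) ≤ M J)) :
    ∀ (L : ℕ), ∃ c₀ : ℝ, 0 < c₀ ∧ c₀ ≤ 1 ∧ ∀ (c : ℝ), 0 < c → c ≤ c₀ → ∃ pS : ℝ, ∀ (b₀ p₀ : ℝ), 0 < b₀ → pS ≤ p₀ → 0 < p₀ →
      ∃ γ₁ : ℝ, 0 < γ₁ ∧ ∀ (F : T3Family) (γ : ℝ), F.L = L → 0 < γ → γ ≤ γ₁ →
        ∃ τ : ℕ → ℝ, (∀ J, 0 ≤ τ J) ∧ (∀ a : ℕ, Tendsto (fun J : ℕ => ((J : ℝ) + 1) ^ a * τ J) atTop (𝓝 0)) ∧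
          ∀ (J : ℕ) (B : Set (GaugeField (F.P J) 0 (Matrix.specialUnitaryGroup (Fin 2) ℂ))), MeasurableSet B →
            B ⊆ {U | PlaqSmall (θBal F.L γ (c * b₀) p₀ J) U} →
            gibbsK F ℰp γ (J + 1) (descendTo F ℰp J (J + 1) (Nat.le_succ J) ⁻¹' B) ≤
              ENNReal.ofReal (Real.exp (τ J)) *
                gibbsK F ℰp γ (J + 1) (descendTo F ℰp J (J + 1) (Nat.le_succ J) ⁻¹' B ∩ histGood F ℰp (θBal F.L γ b₀ p₀) (J + 1) J) := by
  refine condGoodOddsDepthOneInt_of_modTotal_farMoment fun L => ?_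
  obtain ⟨c₀, hc₀, hc₀1, hc⟩ := h L
  refine ⟨c₀, hc₀, hc₀1, fun c hcpos hcle => ?_⟩
  obtain ⟨pS, hpS⟩ := hc c hcpos hcle
  refine ⟨pS, fun b₀ p₀ hb₀ hpS' hp₀ => ?_⟩
  obtain ⟨γ₁, hγ₁, hγ₁F⟩ := hpS b₀ p₀ hb₀ hpS' hp₀
  refine ⟨γ₁, hγ₁, fun F γ hFL hγ hγle => ?_⟩
  obtain ⟨δ₀, J₀, s, q, σm, M, hδ₀, hs0, hshalf, hsa, hσm0, hsmall, hq, hfloor, htail, hfar⟩ := hγ₁F F γ hFL hγ hγle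
  refine ⟨δ₀, J₀, s, q, σm, M, hδ₀, hs0, hshalf, hsa, hσm0, hsmall, hq, hfloor, fun J p B hB hBW => ?_, hfar⟩
  exact pinnedTotal_of_fibrewise F (c * b₀) p₀ (Nat.le_succ J) (measurableSet_modPinned F (θBal F.L γ b₀ p₀ (J + 1)) δ₀ p) (htail J p) hB hBW

/-- ★★★ **⟨FIBRE-TAIL₁∘ + FAR-MOMENT₁∘ + FLOOR⟩ ⇒ TAILSUP₁∘** (LINE g21-2 v1.4's interior row `RunPairOrgan.OneLoop.WindowOddsSupDepthOneIntCan`, text verbatim): §2 then ✓K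
`windowOddsSupDepthOneIntCan_of_condGoodOddsDepthOneInt`.  HONEST SCOPE: (TAIL), (MOMENT) and the smallness are the HYPOTHESIS — the per-plaquette conditional small-field
estimate one level deep and equipartition; nothing upstream is proved here. [cite: Balaban1985UV3, (2) p.256, (7) p.257, (38)-(40) p.266 and (67)-(71) p.273] -/
theorem windowOddsSupDepthOneInt_of_fibreTail_farMoment
    (h : ∀ (L : ℕ), ∃ c₀ : ℝ, 0 < c₀ ∧ c₀ ≤ 1 ∧ ∀ (c : ℝ), 0 < c → c ≤ c₀ → ∃ pS : ℝ, ∀ (b₀ p₀ : ℝ), 0 < b₀ → pS ≤ p₀ → 0 < p₀ →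
      ∃ γ₁ : ℝ, 0 < γ₁ ∧ ∀ (F : T3Family) (γ : ℝ), F.L = L → 0 < γ → γ ≤ γ₁ →
        ∃ (δ₀ : ℝ) (J₀ : ℕ) (s q : ℕ → ℝ) (σm : (J : ℕ) → Plaq (F.P (J + 1)) 0 → ℝ) (M : ℕ → ℝ), 0 ≤ δ₀ ∧ (∀ J, 0 ≤ s J) ∧ (∀ J, J₀ ≤ J → s J ≤ 1 / 2) ∧
          (∀ a : ℕ, Tendsto (fun J : ℕ => ((J : ℝ) + 1) ^ a * s J) atTop (𝓝 0)) ∧ (∀ J p, 0 ≤ σm J p) ∧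
          (∀ J, ∑ p : Plaq (F.P (J + 1)) 0, σm J p +
              (Fintype.card (Plaq (F.P (J + 1)) 0) : ℝ) * (Real.exp (-((F.scheme ℰp γ).β (J + 1) * δ₀ ^ 2 / 4)) * Real.exp (M J)) ≤ s J) ∧
          (∀ J, 0 < q J) ∧
          (∀ (J : ℕ), J < J₀ → ∀ (B : Set (GaugeField (F.P J) 0 (Matrix.specialUnitaryGroup (Fin 2) ℂ))), MeasurableSet B →
            B ⊆ {U | PlaqSmall (θBal F.L γ (c * b₀) p₀ J) U} →
            ENNReal.ofReal (q J) * gibbsK F ℰp γ (J + 1) (descendTo F ℰp J (J + 1) (Nat.le_succ J) ⁻¹' B) ≤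
              gibbsK F ℰp γ (J + 1) (descendTo F ℰp J (J + 1) (Nat.le_succ J) ⁻¹' B ∩ histGood F ℰp (θBal F.L γ b₀ p₀) (J + 1) J)) ∧
          (∀ (J : ℕ) (p : Plaq (F.P (J + 1)) 0),
            ∀ᵐ V ∂((fieldMeasure (F.P (J + 1)) 0 (Matrix.specialUnitaryGroup (Fin 2) ℂ)).map (descendTo F ℰp J (J + 1) (Nat.le_succ J))),
              PlaqSmall (θBal F.L γ (c * b₀) p₀ J) V →
                ∫⁻ U in {U | θBal F.L γ b₀ p₀ (J + 1) ≤ dist1 (GaugeField.plaqHol U p) ∧ dist1 (GaugeField.plaqHol U p) < δ₀},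
                    ENNReal.ofReal (boltzmann (F.P (J + 1)) ((F.scheme ℰp γ).β (J + 1)) U)
                    ∂(condLaw (fieldMeasure (F.P (J + 1)) 0 (Matrix.specialUnitaryGroup (Fin 2) ℂ)) (descendTo F ℰp J (J + 1) (Nat.le_succ J)) V) ≤
                  ENNReal.ofReal (σm J p) * ∫⁻ U, ENNReal.ofReal (boltzmann (F.P (J + 1)) ((F.scheme ℰp γ).β (J + 1)) U)
                    ∂(condLaw (fieldMeasure (F.P (J + 1)) 0 (Matrix.specialUnitaryGroup (Fin 2) ℂ)) (descendTo F ℰp J (J + 1) (Nat.le_succ J)) V)) ∧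
          (∀ (J : ℕ) (p : Plaq (F.P (J + 1)) 0),
            ∀ᵐ V ∂((fieldMeasure (F.P (J + 1)) 0 (Matrix.specialUnitaryGroup (Fin 2) ℂ)).map (descendTo F ℰp J (J + 1) (Nat.le_succ J))),
              PlaqSmall (θBal F.L γ (c * b₀) p₀ J) V →
                ⨍ U, (F.scheme ℰp γ).β (J + 1) * (1 - reTr (GaugeField.plaqHol U p))
                  ∂((condLaw (fieldMeasure (F.P (J + 1)) 0 (Matrix.specialUnitaryGroup (Fin 2) ℂ)) (descendTo F ℰp J (J + 1) (Nat.le_succ J)) V).withDensity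
                    fun U => ENNReal.ofReal (Real.exp (-((F.scheme ℰp γ).β (J + 1) *
                      (wilsonAction4 U - (1 - reTr (GaugeField.plaqHol U p))))))) ≤ M J)) :
    ∀ (L : ℕ), ∃ c₀ : ℝ, 0 < c₀ ∧ c₀ ≤ 1 ∧ ∀ (c : ℝ), 0 < c → c ≤ c₀ → ∃ pS : ℝ, ∀ (b₀ p₀ : ℝ), 0 < b₀ → pS ≤ p₀ → 0 < p₀ →
    ∃ γ₁ : ℝ, 0 < γ₁ ∧ ∀ (F : T3Family) (γ : ℝ), F.L = L → 0 < γ → γ ≤ γ₁ →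
      ∃ τ : ℕ → ℝ, (∀ J, 0 ≤ τ J) ∧ (∀ a : ℕ, Tendsto (fun J : ℕ => ((J : ℝ) + 1) ^ a * τ J) atTop (𝓝 0)) ∧
        ∀ (ν : ℕ → (j : ℕ) → Measure (GaugeField (F.P j) 0 (Matrix.specialUnitaryGroup (Fin 2) ℂ))),
          (∀ K, ν K K = T4GenFunBounds.gibbsMeasure (F.P K) ((F.scheme ℰp γ).β K)) →
          (∀ K j, j < K → ν K j = Measure.map (descend F ℰp j) (ν K (j + 1))) →
          ∀ (J : ℕ) (ρ : GaugeField (F.P J) 0 (Matrix.specialUnitaryGroup (Fin 2) ℂ) → ℝ),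
            (∀ U, PlaqSmall (θBal F.L γ (c * b₀) p₀ J) U → 0 < ρ U) →
            ν (J + 1) J = (fieldMeasure _ _ _).withDensity (fun U => ENNReal.ofReal (ρ U)) →
            ContinuousOn ρ {U | PlaqSmall (θBal F.L γ (c * b₀) p₀ J) U} →
            (∀ U : GaugeField (F.P J) 0 (Matrix.specialUnitaryGroup (Fin 2) ℂ), PlaqSmall (θBal F.L γ (c * b₀) p₀ J) U →
                0 < heightDensityCan F γ (Nat.le_succ J) (histGood F ℰp (θBal F.L γ b₀ p₀) (J + 1) J) U) →
            ∃ a₀ : ℝ, ∀ U : GaugeField (F.P J) 0 (Matrix.specialUnitaryGroup (Fin 2) ℂ), PlaqSmall (θBal F.L γ (c * b₀) p₀ J) U →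
              0 ≤ Real.log (ρ U) - a₀ - Real.log (heightDensityCan F γ (Nat.le_succ J) (histGood F ℰp (θBal F.L γ b₀ p₀) (J + 1) J) U) ∧
              Real.log (ρ U) - a₀ - Real.log (heightDensityCan F γ (Nat.le_succ J) (histGood F ℰp (θBal F.L γ b₀ p₀) (J + 1) J) U) ≤ τ J :=
  FluctuationComparisonRegPrIntLSupTailReductionInt.windowOddsSupDepthOneIntCan_of_condGoodOddsDepthOneInt
    (condGoodOddsDepthOneInt_of_fibreTail_farMoment h)

end Knit

end Summit.QuantumFields.YangMills.Theorems.FluctuationComparisonRegPrIntLSupTailCoverUnionFibreTail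

end
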